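/-
Copyright (c) 2026 the pub-hodgecm-mathlib formalisation cell (harness21).  Prover seat hodgecm-mathlib-K2Liu-p09 (g0): Track B «K2-LIT»,
#184♮ = hLiu418 = stmt-HodgeConjecture-24832, file #9 of the K2_Liu road, organ (III-b) step E5′ (B1a: the Levi matrix and the Levi hom); 2026-09-04.
-/
import Summits.HodgeConjecture.HodgeConjecture.Theorems.K2LiuSiegelDoubledLeviAlgebra      -- ★ `adapt_levi`, `blk_levi`, `levi_mul_levi`, …
import Summits.HodgeConjecture.HodgeConjecture.Theorems.K2LiuSiegelDoubledBlkUnitary       -- ★ `cstar_blk`, `exists_mem_HA_of_cstar`, `blk_injective`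
import Literature.NumberTheory.GelbartRogawski1991.DoubledUnitaryAdaptedBigCell             -- ★ `cstar_mul'`, `cstar_inv_mul_cstar`
import Literature.NumberTheory.GelbartRogawski1991.DoubledWeilRepresentationLocalFamilyCM   -- ★ `gramR_isSymm`, `isUnit_det_gramR₀`
import Literature.NumberTheory.Automorphic.UnitaryGroupOfFormAdelicTopology                 -- ★ `continuous_conjAdele`
import HarnessLib

/-!
# Crux `HLiu418`, Track B road `K2_Liu`, unit U3a «SIEGEL EISENSTEIN SERIES», file #9 — helper 14 (organ (III-b), step E5′, part B1a):
# the Levi matrix `m(A) = R [[A, 0],[0, T⁻¹ (A⁻¹)ᴴ T]] R⁻¹` of the Siegel parabolic and the Levi homomorphism `GL_n(𝔸_L) → H(𝔸)`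

Cell `hodgecm-mathlib`, crux item hLiu418 = `stmt-HodgeConjecture-24832`; squad K2 ∕ K2Liu, prover K2Liu-p09 (g0).  THEOREMS ONLY (no
definition: the Levi matrix is always written out); lane `--supports stmt-HodgeConjecture-24832` (count-neutral helper toward the concrete
Siegel–Levi chart (PLAN v3 §B1) feeding ★ `godement_parabolic_integral` for socket #9 `sig_K2LiuSiegelEisensteinDoubledSummable`).

§1 is pure matrix algebra over a commutative ring `R` with `⅟2`, an involution `σ` and an invertible `σ`-fixed symmetric `T`
(the adapted frame `R = cayR`, `adapt`, `blkA…D` of ★ `AdaptedBlocks`): for `A' A = 1` the block `D = T⁻¹ σ(A')ᵀ T` satisfies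
`σ(A)ᵀ T D = T = σ(D)ᵀ T A` (`cstar_leviD_left/right`), so `m(A) := R [[A,0],[0,D]] R⁻¹ ∈ U(σ, T ⊕ −T)` (`cstar_levi`); the `D`-blocks
multiply (`leviD_mul`), `m(A) m(B) = m(AB)` (`levi_mul_levi_leviD`), and every `M ∈ U(σ, T ⊕ −T)` with `blkB M = blkC M = 0` IS `m(blkA M)`
(`eq_levi_of_blkB_eq_zero`) [HarrisKudlaSweet1996 §1 (1.11): `m(a) = (a, ǎ)`, `ǎ = (a*)⁻¹`].
§2 specialises to `H(𝔸) = U(𝕎 ⊕ −𝕎)(𝔸_{L⁺})` of ★ `GRConstruction`: `T_𝔸 = gramR ⊗ 1` is invertible, symmetric and `(c ⊗ 1)`-fixed, and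
**`exists_leviHom`** — there is a CONTINUOUS homomorphism `Λ : GL_n(𝔸_L) →* H(𝔸)` with `blk (Λ g) = m(g)` (★ `exists_mem_HA_of_cstar`,
★ `blk_injective`; continuity in the units topology from the polynomial formula in `(g, g⁻¹)`), together with `IsSiegelDelta (Λ g)`,
`deltaBlock (Λ g) = g`.

HONEST LABEL.  Count-neutral helper of the K2_Liu road; it retires nothing by itself: `HC_CM` is proved only modulo the 7 printed
citations (2 remaining named inputs: hLiu418 = `stmt-HodgeConjecture-24832`, h413 = `stmt-HodgeConjecture-24833`) until rung 0 closes.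

## References
* [HarrisKudlaSweet1996] M. Harris, S. S. Kudla, W. J. Sweet, J. Amer. Math. Soc. 9 (1996), §1 (1.11) (`m(a)`, the Siegel Levi).
* [Kudla1994] S. S. Kudla, Israel J. Math. 87 (1994), §3.
* [Garrett2018] P. Garrett, *Modern Analysis of Automorphic Forms by Example* (2018), §3.10.
-/

set_option autoImplicit false
-- the mandated namespace repeats the single-problem summit's segment (`HodgeConjecture.HodgeConjecture`)
set_option linter.dupNamespace false

noncomputable section

open scoped Matrix
open NumberField IsDedekindDomain

namespace Summit.HodgeConjecture.HodgeConjecture.Cruxes.HLiu418.K2LiuSiegelDoubledLeviMatrix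

open Literature.NumberTheory.GelbartRogawski1991.AdaptedBlocks
open Summit.HodgeConjecture.HodgeConjecture.Cruxes.HLiu418.K2LiuSiegelDoubledLeviAlgebra

/-! ## §1 The Levi matrix over a commutative ring -/

section Ring

variable {R : Type*} [CommRing R] {ι : Type*} [Fintype ι] [DecidableEq ι] {σ : R →+* R} {T : Matrix ι ι R}

omit [Fintype ι] [DecidableEq ι] in
/-- `σ(σ(X)) = X` entrywise for an involution `σ`. [folklore] -/
theorem map_map_of_involutive (hσ : ∀ x, σ (σ x) = x) (X : Matrix ι ι R) : (X.map σ).map σ = X := by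
  ext i j; simp [hσ]

/-- For `σ`-fixed invertible `T`: `σ(T⁻¹) = T⁻¹`. [folklore] -/
theorem map_nonsing_inv_eq (hT : IsUnit T.det) (hTσ : T.map σ = T) : T⁻¹.map σ = T⁻¹ := by
  have h : T⁻¹.map σ * T = 1 := by
    calc T⁻¹.map σ * T = T⁻¹.map σ * T.map σ := by rw [hTσ]
      _ = 1 := by rw [← Matrix.map_mul, Matrix.nonsing_inv_mul T hT, Matrix.map_one σ (map_zero σ) (map_one σ)]
  exact (Matrix.inv_eq_left_inv h).symm

/-- **`σ(A)ᵀ T D = T`** for `D = T⁻¹ σ(A')ᵀ T`, `A' A = 1`. [cite: HarrisKudlaSweet1996, §1 (1.11)] -/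
theorem cstar_leviD_left (hT : IsUnit T.det) {A A' : Matrix ι ι R} (hA'A : A' * A = 1) :
    (A.map σ)ᵀ * T * (T⁻¹ * (A'.map σ)ᵀ * T) = T := by
  calc (A.map σ)ᵀ * T * (T⁻¹ * (A'.map σ)ᵀ * T) = (A.map σ)ᵀ * (T * T⁻¹) * (A'.map σ)ᵀ * T := by
        simp only [Matrix.mul_assoc]
    _ = T := by
        rw [Matrix.mul_nonsing_inv T hT, Matrix.mul_one, ← cstar_mul', hA'A, Matrix.map_one σ (map_zero σ) (map_one σ),
          Matrix.transpose_one, Matrix.one_mul]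

/-- **`σ(D)ᵀ T A = T`** for `D = T⁻¹ σ(A')ᵀ T`, `A' A = 1` (`σ` an involution, `T` symmetric and `σ`-fixed).
[cite: HarrisKudlaSweet1996, §1 (1.11)] -/
theorem cstar_leviD_right (hT : IsUnit T.det) (hTσ : T.map σ = T) (hTt : Tᵀ = T) (hσ : ∀ x, σ (σ x) = x)
    {A A' : Matrix ι ι R} (hA'A : A' * A = 1) :
    ((T⁻¹ * (A'.map σ)ᵀ * T).map σ)ᵀ * T * A = T := by
  have h1 : ((T⁻¹ * (A'.map σ)ᵀ * T).map σ)ᵀ = T * A' * T⁻¹ := by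
    rw [Matrix.map_mul, Matrix.map_mul, map_nonsing_inv_eq hT hTσ, hTσ, Matrix.transpose_map, map_map_of_involutive hσ,
      Matrix.transpose_mul, Matrix.transpose_mul, Matrix.transpose_transpose, hTt, Matrix.transpose_nonsing_inv, hTt,
      Matrix.mul_assoc]
  rw [h1]
  calc T * A' * T⁻¹ * T * A = T * A' * (T⁻¹ * T) * A := by simp only [Matrix.mul_assoc]
    _ = T := by rw [Matrix.nonsing_inv_mul T hT, Matrix.mul_one, Matrix.mul_assoc, hA'A, Matrix.mul_one]

variable [Invertible (2 : R)]

/-- **The Levi matrix is unitary**: `m(A) = R [[A,0],[0,T⁻¹ σ(A')ᵀ T]] R⁻¹ ∈ U(σ, T ⊕ −T)` when `A' A = 1`.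
[cite: HarrisKudlaSweet1996, §1 (1.11)] [cite: Garrett2018, §3.10] -/
theorem cstar_levi (hT : IsUnit T.det) (hTσ : T.map σ = T) (hTt : Tᵀ = T) (hσ : ∀ x, σ (σ x) = x)
    {A A' : Matrix ι ι R} (hA'A : A' * A = 1) :
    ((cayR R ι * Matrix.fromBlocks A 0 0 (T⁻¹ * (A'.map σ)ᵀ * T) * cayRinv R ι).map σ)ᵀ * Matrix.fromBlocks T 0 0 (-T) *
        (cayR R ι * Matrix.fromBlocks A 0 0 (T⁻¹ * (A'.map σ)ᵀ * T) * cayRinv R ι) = Matrix.fromBlocks T 0 0 (-T) := by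
  refine cstar_mul_diag_mul_of_conj (σ := σ) (T := T) ?_
  rw [cstar_blockUpper σ ((2 : R) • T) A 0 (T⁻¹ * (A'.map σ)ᵀ * T)]
  have h1 : (A.map σ)ᵀ * ((2 : R) • T) * (T⁻¹ * (A'.map σ)ᵀ * T) = (2 : R) • T := by
    rw [Matrix.mul_smul, Matrix.smul_mul, cstar_leviD_left hT hA'A]
  have h2 : ((T⁻¹ * (A'.map σ)ᵀ * T).map σ)ᵀ * ((2 : R) • T) * A = (2 : R) • T := by
    rw [Matrix.mul_smul, Matrix.smul_mul, cstar_leviD_right hT hTσ hTt hσ hA'A]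
  simp only [h1, h2, Matrix.mul_zero, Matrix.map_zero _ (map_zero σ), Matrix.transpose_zero, Matrix.zero_mul, add_zero]

omit [Invertible (2 : R)] in
/-- **The `D`-blocks multiply**: `(T⁻¹ σ(A')ᵀ T)(T⁻¹ σ(B')ᵀ T) = T⁻¹ σ(B' A')ᵀ T`. [cite: HarrisKudlaSweet1996, §1 (1.11)] -/
theorem leviD_mul (hT : IsUnit T.det) (A' B' : Matrix ι ι R) :
    T⁻¹ * (A'.map σ)ᵀ * T * (T⁻¹ * (B'.map σ)ᵀ * T) = T⁻¹ * ((B' * A').map σ)ᵀ * T := by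
  calc T⁻¹ * (A'.map σ)ᵀ * T * (T⁻¹ * (B'.map σ)ᵀ * T) = T⁻¹ * (A'.map σ)ᵀ * (T * T⁻¹) * (B'.map σ)ᵀ * T := by
        simp only [Matrix.mul_assoc]
    _ = T⁻¹ * ((B' * A').map σ)ᵀ * T := by rw [Matrix.mul_nonsing_inv T hT, Matrix.mul_one, cstar_mul', Matrix.mul_assoc T⁻¹]

omit [Invertible (2 : R)] in
/-- The `D`-block of the identity is the identity. [folklore] -/
theorem leviD_one (hT : IsUnit T.det) : T⁻¹ * ((1 : Matrix ι ι R).map σ)ᵀ * T = 1 := by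
  rw [Matrix.map_one σ (map_zero σ) (map_one σ), Matrix.transpose_one, Matrix.mul_one, Matrix.nonsing_inv_mul T hT]

/-- **`m(A) m(B) = m(A B)`** (with inverse blocks `A'`, `B'`: `(AB)' = B' A'`). [cite: HarrisKudlaSweet1996, §1 (1.11)] -/
theorem levi_mul_levi_leviD (hT : IsUnit T.det) (A A' B B' : Matrix ι ι R) :
    cayR R ι * Matrix.fromBlocks A 0 0 (T⁻¹ * (A'.map σ)ᵀ * T) * cayRinv R ι *
        (cayR R ι * Matrix.fromBlocks B 0 0 (T⁻¹ * (B'.map σ)ᵀ * T) * cayRinv R ι) =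
      cayR R ι * Matrix.fromBlocks (A * B) 0 0 (T⁻¹ * ((B' * A').map σ)ᵀ * T) * cayRinv R ι := by
  rw [levi_mul_levi, leviD_mul hT]

/-- The Levi matrix of `1` is `1`. [folklore] -/
theorem levi_one_leviD (hT : IsUnit T.det) :
    cayR R ι * Matrix.fromBlocks (1 : Matrix ι ι R) 0 0 (T⁻¹ * ((1 : Matrix ι ι R).map σ)ᵀ * T) * cayRinv R ι = 1 := by
  rw [leviD_one hT, Matrix.fromBlocks_one, Matrix.mul_one, cayR_mul_cayRinv]

/-- **A unitary matrix with `blkB = blkC = 0` is the Levi matrix of its `A`-block**: from ★ `rel₁₂` (`σ(A)ᵀ T D = T` at `C = 0`)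
`D = T⁻¹ σ(A⁻¹)ᵀ T`, and `M = R (adapt M) R⁻¹`. [cite: HarrisKudlaSweet1996, §1 (1.11)] -/
theorem eq_levi_of_blkB_eq_zero (hT : IsUnit T.det) {M : Matrix (ι ⊕ ι) (ι ⊕ ι) R}
    (hM : (M.map σ)ᵀ * Matrix.fromBlocks T 0 0 (-T) * M = Matrix.fromBlocks T 0 0 (-T)) (hC : blkC M = 0) (hB : blkB M = 0)
    (hA : IsUnit (blkA M).det) :
    M = cayR R ι * Matrix.fromBlocks (blkA M) 0 0 (T⁻¹ * (((blkA M)⁻¹).map σ)ᵀ * T) * cayRinv R ι := by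
  have h12 := rel₁₂ (σ := σ) (T := T) hM
  rw [hC, Matrix.map_zero _ (map_zero σ), Matrix.transpose_zero, Matrix.zero_mul, Matrix.zero_mul, zero_add] at h12
  -- `D = T⁻¹ σ(A⁻¹)ᵀ T`
  have hD : blkD M = T⁻¹ * (((blkA M)⁻¹).map σ)ᵀ * T := by
    have h := congrArg (fun X => T⁻¹ * (((blkA M)⁻¹).map σ)ᵀ * X) h12
    rw [show T⁻¹ * (((blkA M)⁻¹).map σ)ᵀ * (((blkA M).map σ)ᵀ * T * blkD M) =
        T⁻¹ * ((((blkA M)⁻¹).map σ)ᵀ * ((blkA M).map σ)ᵀ) * T * blkD M by simp only [Matrix.mul_assoc],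
      cstar_inv_mul_cstar hA, Matrix.mul_one, Matrix.nonsing_inv_mul T hT, Matrix.one_mul] at h
    exact h
  conv_lhs => rw [eq_conj_fromBlocks_of_blkC_eq_zero hC, hB, hD]

end Ring

/-! ## §2 The Levi homomorphism `Λ : GL_n(𝔸_L) →* H(𝔸)` -/

section Doubled

open Literature.NumberTheory.Automorphic Literature.NumberTheory.Automorphic.UnitaryGroup
open Literature.NumberTheory.GelbartRogawski1991 Literature.NumberTheory.GelbartRogawski1991.GRConstruction
open UnitaryDualPair
open Summit.HodgeConjecture.HodgeConjecture.Cruxes.HLiu418.K2LiuSiegelDoubledBlkUnitary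
open Summit.HodgeConjecture.HodgeConjecture.Cruxes.HLiu418.K2LiuSiegelDoubledIwasawaCompact (conjAdele_algebraMap_algebraMap)

variable (L : Type) [Field L] [NumberField L] [IsCMField L]
variable {N M n : ℕ} (e : Fin N × Fin M ≃ Fin n)
  (dV : Fin N → L) (hdV : ∀ i, IsCMField.complexConj L (dV i) = dV i)
  (dW : Fin M → L) (hdW : ∀ i, IsCMField.complexConj L (dW i) = dW i)

/-- `(c ⊗ 1)` is an involution of `𝔸_L`. [folklore] -/
theorem conjAdele_conjAdele' (x : AdeleRing (𝓞 L) L) :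
    conjAdele (Fp L) L (IsCMField.complexConj L) (conjAdele (Fp L) L (IsCMField.complexConj L) x) = x := by
  have hc : IsCMField.complexConj L * IsCMField.complexConj L = 1 := AlgEquiv.ext fun y => IsCMField.complexConj_apply_apply L y
  rw [conjAdele_apply, conjAdele_apply, smul_smul, hc, one_smul]

/-- `T_𝔸 = gramR ⊗ 1` is `(c ⊗ 1)`-fixed. [cite: GelbartRogawski1991, §3.1 Prop. 3.1.1 p. 455 L1–2] -/
theorem gramRA_map_conjAdele :
    ((gramR L e dV hdV dW hdW).map ((algebraMap L (AdeleRing (𝓞 L) L)).comp (algebraMap (Fp L) L))).map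
        (conjAdele (Fp L) L (IsCMField.complexConj L)) =
      (gramR L e dV hdV dW hdW).map ((algebraMap L (AdeleRing (𝓞 L) L)).comp (algebraMap (Fp L) L)) := by
  ext i j
  exact conjAdele_algebraMap_algebraMap L _

/-- `T_𝔸` is symmetric. [cite: GelbartRogawski1991, §3.1 Prop. 3.1.1 p. 455 L1–2] -/
theorem gramRA_transpose :
    ((gramR L e dV hdV dW hdW).map ((algebraMap L (AdeleRing (𝓞 L) L)).comp (algebraMap (Fp L) L)))ᵀ =
      (gramR L e dV hdV dW hdW).map ((algebraMap L (AdeleRing (𝓞 L) L)).comp (algebraMap (Fp L) L)) := by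
  rw [← Matrix.transpose_map, (gramR_isSymm L e dV hdV dW hdW).eq]

/-- `det T_𝔸` is a unit (non-degeneracy `dV, dW ≠ 0`). [cite: GelbartRogawski1991, §3.1 Prop. 3.1.1 p. 455 L1–2] -/
theorem isUnit_det_gramRA (hdV0 : ∀ i, dV i ≠ 0) (hdW0 : ∀ i, dW i ≠ 0) :
    IsUnit ((gramR L e dV hdV dW hdW).map ((algebraMap L (AdeleRing (𝓞 L) L)).comp (algebraMap (Fp L) L))).det := by
  have h : (gramR L e dV hdV dW hdW).map ((algebraMap L (AdeleRing (𝓞 L) L)).comp (algebraMap (Fp L) L)) =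
      ((algebraMap L (AdeleRing (𝓞 L) L)).comp (algebraMap (Fp L) L)).mapMatrix (gramR L e dV hdV dW hdW) := rfl
  rw [h, ← RingHom.map_det]
  exact (isUnit_det_gramR₀ L e dV hdV hdV0 dW hdW hdW0).map _

/-- **The Levi element with prescribed `A`-block**: for `g ∈ GL_n(𝔸_L)` there is `q ∈ H(𝔸)` with `blk q = m(g)`.
[cite: HarrisKudlaSweet1996, §1 (1.11)] -/
theorem exists_levi (hdV0 : ∀ i, dV i ≠ 0) (hdW0 : ∀ i, dW i ≠ 0) (g : GL (Fin n) (AdeleRing (𝓞 L) L)) :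
    ∃ q : HA L e dV hdV dW hdW, blk L e dV hdV dW hdW q =
      cayR (AdeleRing (𝓞 L) L) (Fin n) * Matrix.fromBlocks (g : Matrix (Fin n) (Fin n) (AdeleRing (𝓞 L) L)) 0 0
        (((gramR L e dV hdV dW hdW).map ((algebraMap L (AdeleRing (𝓞 L) L)).comp (algebraMap (Fp L) L)))⁻¹ *
          (((g⁻¹ : GL (Fin n) (AdeleRing (𝓞 L) L)) : Matrix (Fin n) (Fin n) (AdeleRing (𝓞 L) L)).map
            (conjAdele (Fp L) L (IsCMField.complexConj L)))ᵀ *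
          (gramR L e dV hdV dW hdW).map ((algebraMap L (AdeleRing (𝓞 L) L)).comp (algebraMap (Fp L) L))) *
        cayRinv (AdeleRing (𝓞 L) L) (Fin n) := by
  have hT := isUnit_det_gramRA L e dV hdV dW hdW hdV0 hdW0
  have hg'g : ((g⁻¹ : GL (Fin n) (AdeleRing (𝓞 L) L)) : Matrix (Fin n) (Fin n) (AdeleRing (𝓞 L) L)) * g = 1 := by
    rw [← Units.val_mul, inv_mul_cancel, Units.val_one]
  have hgg' : (g : Matrix (Fin n) (Fin n) (AdeleRing (𝓞 L) L)) * (g⁻¹ : GL (Fin n) (AdeleRing (𝓞 L) L)) = 1 := by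
    rw [← Units.val_mul, mul_inv_cancel, Units.val_one]
  refine exists_mem_HA_of_cstar L e dV hdV dW hdW (Y := cayR (AdeleRing (𝓞 L) L) (Fin n) *
      Matrix.fromBlocks (((g⁻¹ : GL (Fin n) (AdeleRing (𝓞 L) L)) : Matrix (Fin n) (Fin n) (AdeleRing (𝓞 L) L))) 0 0
        (((gramR L e dV hdV dW hdW).map ((algebraMap L (AdeleRing (𝓞 L) L)).comp (algebraMap (Fp L) L)))⁻¹ *
          ((g : Matrix (Fin n) (Fin n) (AdeleRing (𝓞 L) L)).map (conjAdele (Fp L) L (IsCMField.complexConj L)))ᵀ *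
          (gramR L e dV hdV dW hdW).map ((algebraMap L (AdeleRing (𝓞 L) L)).comp (algebraMap (Fp L) L))) *
      cayRinv (AdeleRing (𝓞 L) L) (Fin n)) ?_ ?_ ?_
  · rw [levi_mul_levi_leviD hT, hgg', levi_one_leviD hT]
  · rw [levi_mul_levi_leviD hT, hg'g, levi_one_leviD hT]
  · exact cstar_levi hT (gramRA_map_conjAdele L e dV hdV dW hdW) (gramRA_transpose L e dV hdV dW hdW) (conjAdele_conjAdele' L) hg'g

/-- **The Levi homomorphism** `Λ : GL_n(𝔸_L) →* H(𝔸)`, CONTINUOUS, with `blk (Λ g) = m(g) = R [[g,0],[0,T_𝔸⁻¹ σ(g⁻¹)ᵀ T_𝔸]] R⁻¹`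
(★ `exists_mem_HA_of_cstar`, uniqueness ★ `blk_injective`, multiplicativity `levi_mul_levi_leviD`; continuity in the units topology:
both `Λ g` and `(Λ g)⁻¹ = Λ g⁻¹` are polynomial in `(g, g⁻¹)`). [cite: HarrisKudlaSweet1996, §1 (1.11)] [cite: Garrett2018, §3.10] -/
theorem exists_leviHom (hdV0 : ∀ i, dV i ≠ 0) (hdW0 : ∀ i, dW i ≠ 0) :
    ∃ Λ : GL (Fin n) (AdeleRing (𝓞 L) L) →* HA L e dV hdV dW hdW, Continuous Λ ∧ ∀ g, blk L e dV hdV dW hdW (Λ g) =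
      cayR (AdeleRing (𝓞 L) L) (Fin n) * Matrix.fromBlocks (g : Matrix (Fin n) (Fin n) (AdeleRing (𝓞 L) L)) 0 0
        (((gramR L e dV hdV dW hdW).map ((algebraMap L (AdeleRing (𝓞 L) L)).comp (algebraMap (Fp L) L)))⁻¹ *
          (((g⁻¹ : GL (Fin n) (AdeleRing (𝓞 L) L)) : Matrix (Fin n) (Fin n) (AdeleRing (𝓞 L) L)).map
            (conjAdele (Fp L) L (IsCMField.complexConj L)))ᵀ *
          (gramR L e dV hdV dW hdW).map ((algebraMap L (AdeleRing (𝓞 L) L)).comp (algebraMap (Fp L) L))) *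
        cayRinv (AdeleRing (𝓞 L) L) (Fin n) := by
  have hT := isUnit_det_gramRA L e dV hdV dW hdW hdV0 hdW0
  choose Λ₀ hΛ₀ using exists_levi L e dV hdV dW hdW hdV0 hdW0
  have hmul : ∀ g h, Λ₀ (g * h) = Λ₀ g * Λ₀ h := by
    intro g h
    apply blk_injective L e dV hdV dW hdW
    rw [blk_mul, hΛ₀, hΛ₀, hΛ₀, levi_mul_levi_leviD hT, Units.val_mul, mul_inv_rev, Units.val_mul]
  have hone : Λ₀ 1 = 1 := by
    apply blk_injective L e dV hdV dW hdW
    rw [hΛ₀, blk_one, Units.val_one, inv_one, Units.val_one, levi_one_leviD hT]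
  refine ⟨{ toFun := Λ₀, map_one' := hone, map_mul' := hmul }, ?_, fun g => hΛ₀ g⟩
  -- continuity
  have hσc : Continuous (conjAdele (Fp L) L (IsCMField.complexConj L)) := continuous_conjAdele (Fp L) L _
  -- the matrix of `Λ₀ g` as a continuous function of `g`
  have hmat : ∀ g, ((Λ₀ g : GL (Fin (n + n)) (AdeleRing (𝓞 L) L)) : Matrix (Fin (n + n)) (Fin (n + n)) (AdeleRing (𝓞 L) L)) =
      Matrix.reindex (e₂ (n := n)) (e₂ (n := n)) (blk L e dV hdV dW hdW (Λ₀ g)) := fun g =>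
    (reindex_reindex_symm _).symm
  have hc1 : Continuous fun g : GL (Fin n) (AdeleRing (𝓞 L) L) =>
      cayR (AdeleRing (𝓞 L) L) (Fin n) * Matrix.fromBlocks (g : Matrix (Fin n) (Fin n) (AdeleRing (𝓞 L) L)) 0 0
        (((gramR L e dV hdV dW hdW).map ((algebraMap L (AdeleRing (𝓞 L) L)).comp (algebraMap (Fp L) L)))⁻¹ *
          (((g⁻¹ : GL (Fin n) (AdeleRing (𝓞 L) L)) : Matrix (Fin n) (Fin n) (AdeleRing (𝓞 L) L)).map
            (conjAdele (Fp L) L (IsCMField.complexConj L)))ᵀ *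
          (gramR L e dV hdV dW hdW).map ((algebraMap L (AdeleRing (𝓞 L) L)).comp (algebraMap (Fp L) L))) *
        cayRinv (AdeleRing (𝓞 L) L) (Fin n) := by
    refine Continuous.matrix_mul (Continuous.matrix_mul continuous_const ?_) continuous_const
    refine Continuous.matrix_fromBlocks Units.continuous_val
      (continuous_const : Continuous fun _ : GL (Fin n) (AdeleRing (𝓞 L) L) => (0 : Matrix (Fin n) (Fin n) (AdeleRing (𝓞 L) L)))
      (continuous_const : Continuous fun _ : GL (Fin n) (AdeleRing (𝓞 L) L) => (0 : Matrix (Fin n) (Fin n) (AdeleRing (𝓞 L) L))) ?_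
    refine Continuous.matrix_mul (Continuous.matrix_mul continuous_const ?_) continuous_const
    exact ((Units.continuous_coe_inv.matrix_map hσc)).matrix_transpose
  have hcont : Continuous fun g : GL (Fin n) (AdeleRing (𝓞 L) L) =>
      ((Λ₀ g : GL (Fin (n + n)) (AdeleRing (𝓞 L) L)) : Matrix (Fin (n + n)) (Fin (n + n)) (AdeleRing (𝓞 L) L)) := by
    simp_rw [hmat, hΛ₀, Matrix.reindex_apply]
    exact hc1.matrix_submatrix _ _
  refine continuous_induced_rng.2 (Units.continuous_iff.2 ⟨hcont, ?_⟩)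
  have hinv : ∀ g : GL (Fin n) (AdeleRing (𝓞 L) L), (((Λ₀ g : GL (Fin (n + n)) (AdeleRing (𝓞 L) L))⁻¹ :
      GL (Fin (n + n)) (AdeleRing (𝓞 L) L)) : Matrix (Fin (n + n)) (Fin (n + n)) (AdeleRing (𝓞 L) L)) =
      ((Λ₀ g⁻¹ : GL (Fin (n + n)) (AdeleRing (𝓞 L) L)) : Matrix (Fin (n + n)) (Fin (n + n)) (AdeleRing (𝓞 L) L)) := by
    intro g
    have h : Λ₀ g⁻¹ = (Λ₀ g)⁻¹ := eq_inv_of_mul_eq_one_left (by rw [← hmul, inv_mul_cancel, hone])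
    rw [h]; rfl
  change Continuous fun g => (((Λ₀ g : GL (Fin (n + n)) (AdeleRing (𝓞 L) L))⁻¹ : GL (Fin (n + n)) (AdeleRing (𝓞 L) L)) :
    Matrix (Fin (n + n)) (Fin (n + n)) (AdeleRing (𝓞 L) L))
  simp_rw [hinv]
  exact hcont.comp continuous_inv

/-- The Levi matrix lies in the Siegel parabolic: `blkC (m(g)) = 0`, i.e. `IsSiegelDelta`. [cite: HarrisKudlaSweet1996, §1 (1.11)] -/
theorem isSiegelDelta_of_blk_eq_levi {q : HA L e dV hdV dW hdW} {A D : Matrix (Fin n) (Fin n) (AdeleRing (𝓞 L) L)}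
    (hq : blk L e dV hdV dW hdW q = cayR (AdeleRing (𝓞 L) L) (Fin n) * Matrix.fromBlocks A 0 0 D * cayRinv (AdeleRing (𝓞 L) L) (Fin n)) :
    IsSiegelDelta L e dV hdV dW hdW q := by
  rw [IsSiegelDelta, ← blkC_eq_zero_iff, hq]
  exact (blk_levi A D).2.2.1

/-- The `Δ`-block of a Levi element is its `A`-block: `deltaBlock q = A`. [cite: HarrisKudlaSweet1996, §1 (1.11)] -/
theorem deltaBlock_of_blk_eq_levi {q : HA L e dV hdV dW hdW} {A D : Matrix (Fin n) (Fin n) (AdeleRing (𝓞 L) L)}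
    (hq : blk L e dV hdV dW hdW q = cayR (AdeleRing (𝓞 L) L) (Fin n) * Matrix.fromBlocks A 0 0 D * cayRinv (AdeleRing (𝓞 L) L) (Fin n)) :
    deltaBlock L e dV hdV dW hdW q = A := by
  rw [deltaBlock, ← blkA_add_blkC, hq, (blk_levi A D).1, (blk_levi A D).2.2.1, add_zero]

end Doubled

end Summit.HodgeConjecture.HodgeConjecture.Cruxes.HLiu418.K2LiuSiegelDoubledLeviMatrix

end
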